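import Summits.BirchSwinnertonDyer.BirchSwinnertonDyer.Theorems.AdditiveBranchIMCGordTwoRankOneUnitCoeff
import Summits.BirchSwinnertonDyer.BirchSwinnertonDyer.Theorems.AdditiveBranchIMCGordTwoRankOneVisibilityCert
import HarnessLib

/-!
# Crux `GordTwoRankOne` (item 19358): `BSD(E,3)` on the CONTENT window of X4♯(G-ord, `e = 2`) ∩ surj ∩ `r_an = 1` from the
# Kato half + the cyclotomic-line identity + `A′(E,3) ≠ 0` (UPPER) and rank-one two-witness VISIBILITY (LOWER) — the booking door

Cell `bsd-addord`, seat `bsd-addord-k1-c3` (D-0074 row B2), gen 7; sibling of `…GordTwoRankOneContentWindowDescent.lean` (gen 5,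
`classX4Gord_bsdp_rankOne_three_of_katoHalf_of_branchCoeffOneNeZero_of_descent`: the same door with the LOWER half from an exact
`3`-descent datum `9 ∣ #Sel₃(E)`, which has no kernel decider) and of the visibility doors `…GordTwoRankOneVisibility[Cert].lean`
(this gen). HONEST FRAMING: nothing here proves the Birch–Swinnerton-Dyer conjecture or the crux; THEOREMS ONLY; per pair (an OFFER
shape for referee A); NOT a class theorem; nothing booked by this file.

## What

`classX4Gord_bsdp_rankOne_three_of_katoHalf_of_branchCoeffOneNeZero_of_twoWitnesses`: on an X4♯(G-ord) row at `p = 3` with `ρ̄`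
onto and `r_an = 1`, `BSD(E,3)` from: the Kato half-eigenspace reading `hK`, Cassels–Tate `hCT`, the cite-only facts `hCyc hArt h73
hWald hmod hmodD hmodN hGZK`, the weak certificate `A′(E,3) ≠ 0` (`BranchCoeffOneNeZeroAt W 3`, two-engine), the datum `#Ш(E)_an = s`
with `ord₃ s ≤ 2`, and the VISIBILITY data of `missingLowerBoundAt_rankOne_irr_of_twoWitnesses_locallyDivisible` (a `3`-congruent
partner `W'` with two witnesses independent mod `3W'(ℚ)` and options (a)/(b) at the places of `S`) — on the four content keys with
kernel records (`…GordTwoRankOneVisibilityRecord{205623g1,355392y1,417024bc1,449352f1}.lean`) every visibility datum but `θ` is in the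
kernel. UPPER half verbatim as the descent sibling (`classX4Gord_missingUpperBoundAt_rankOne_of_katoHalf_of_identity_odd` on the
datum/identity of `exists_datum_identity_three_of_facts`, Schneider from `A′ ≠ 0`; `¬CM` automatic from `surj`).
-/

set_option autoImplicit false
set_option linter.dupNamespace false

noncomputable section

open scoped Classical MatrixGroups ModularForm NumberField
open CongruenceSubgroup WeierstrassCurve NumberField IsDedekindDomain Field
  Literature.NumberTheory.EllipticCurves Literature.NumberTheory.EllipticCurves.ModularForms
  Literature.NumberTheory.EllipticCurves.GreenbergVatsal2000
  Literature.NumberTheory.EllipticCurves.Rank1Residual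
  Literature.NumberTheory.EllipticCurves.Rank1Residual.Typed
  Literature.NumberTheory.EllipticCurves.Delbourgo2002
  Literature.NumberTheory.EllipticCurves.Disegni2017
  Literature.NumberTheory.GaloisRepresentations
  Summit.BirchSwinnertonDyer.Rank1Residual.AdditivePotMult
  Summit.BirchSwinnertonDyer.Rank1Residual.Additive
  Summit.BirchSwinnertonDyer.Rank1Residual.GaloisImage

namespace Summit.BirchSwinnertonDyer.BirchSwinnertonDyer.Theorems.AdditiveBranchIMCGordTwoRankOne

open Summit.BirchSwinnertonDyer.BirchSwinnertonDyer.Theorems.AdditiveBranchIMCGordTwoRankOneVisibility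

/-- **X4♯(G-ord) ∩ surj at `p = 3`, `r_an(E) = 1`, CONTENT window: `BSD(E,3)` from the Kato half, the cite-only facts, `A′(E,3) ≠ 0`,
the datum `ord₃ #Ш_an ≤ 2`, and two-witness VISIBILITY data** (`W'`, `θ`, `S`, witnesses `P₁ P₂` independent mod `3W'(ℚ)`, options
(a)/(b) per place). LOWER half = `missingLowerBoundAt_rankOne_irr_of_twoWitnesses_locallyDivisible` (Ш[3] ≠ 0 by visibility,
Cassels–Tate squareness); UPPER half = `classX4Gord_missingUpperBoundAt_rankOne_of_katoHalf_of_identity_odd` (verbatim as in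
`…_of_descent`). Per pair; NOT a class theorem; nothing booked. [cite: CremonaMazur2000, §3] [cite: AgasheStein2002, Lemma 3.6]
[cite: SilvermanAEC2009, Thm. X.4.14] [cite: Kato2004Asterisque, Thm. 17.4 (3) (p. 273)] [cite: Wuthrich2014, Thm. 16 (p. 397)]
[cite: Delbourgo2002, Theorem (B), Example (p. 40)] [cite: Disegni2017, Theorem A/B (arXiv v3 PDF 7–9)] [cite: Miller2011LMS, Def. 1.1] -/
theorem classX4Gord_bsdp_rankOne_three_of_katoHalf_of_branchCoeffOneNeZero_of_twoWitnesses
    [Fact (Nat.Prime 3)] {W : WeierstrassCurve ℚ} [W.IsElliptic] [W.IsGloballyMinimal]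
    (hK : Wuthrich2014.kato_halfEigenCharIdeal_dvd_cyclotomicPrime_of_surjective)
    (hCT : exists_casselsTate_pairing (K := ℚ)) (hCyc : delbourgoDatum_cycLineGrossZagier)
    (hArt : rankinSelbergEulerProductHecke_baseChangeDirichlet_eq) (h73 : GrossZagier1986_thm_I_7_3)
    (hWald : waldspurger_exists_heegnerField_twist_ne_zero)
    (hmod : hasEntireLFunction_rat) (hmodD : nonempty_modularParametrizationData)
    (hmodN : exists_isNewformOf) (hGZK : rank_eq_analyticRank_of_analyticRank_le_one)
    (hX : ClassX4Gord W 3) (hsurj : Surj W 3) (hr : W.analyticRank = 1) (hne : BranchCoeffOneNeZeroAt W 3)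
    {s : ℚ} (hs : shaAn W = (s : ℂ)) (hsv : padicValRat 3 s ≤ 2)
    (W' : WeierstrassCurve ℚ) [W'.IsElliptic]
    (θ : geomTorsion W' (3 : ℤ) ≃+ geomTorsion W (3 : ℤ))
    (hθ : ∀ (σ : absoluteGaloisGroup ℚ) (P : geomTorsion W' (3 : ℤ)), θ (σ • P) = σ • θ P)
    (S : Finset (HeightOneSpectrum (𝓞 ℚ)))
    (hS : ∀ w : HeightOneSpectrum (𝓞 ℚ), w ∉ S →
      W.HasGoodReductionAt w ∧ W'.HasGoodReductionAt w ∧ ((3 : ℕ) : 𝓞 ℚ) ∉ w.asIdeal)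
    (P₁ P₂ : W'.toAffine.Point)
    (hind : ∀ a b : ℤ, a • P₁ + b • P₂ ∈
      (zsmulAddGroupHom ((3 : ℕ) : ℤ) : W'.toAffine.Point →+ W'.toAffine.Point).range →
      ((3 : ℕ) : ℤ) ∣ a ∧ ((3 : ℕ) : ℤ) ∣ b)
    (hdiv : ∀ P ∈ [P₁, P₂], ∀ w ∈ S,
      (∃ Q : (W'.baseChange (w.adicCompletion ℚ)).toAffine.Point,
        3 • Q = WeierstrassCurve.Affine.Point.baseChange (W' := W') ℚ (w.adicCompletion ℚ) P) ∨
      (((3 : ℕ) : 𝓞 ℚ) ∉ w.asIdeal ∧ Nat.card (nsmulAddMonoidHom 3 :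
        (W'.baseChange (w.adicCompletion ℚ)).toAffine.Point →+ _).ker = 1)) : BSDp W 3 := by
  have hp4 : (3 : ℕ) % 4 = 3 := by norm_num
  have hp2 : (3 : ℕ) ≠ 2 := by norm_num
  have hcm : ¬ W.HasCM := not_hasCM_of_surj_of_ne_two hp2 hsurj
  have he : semistabilityIndex W 3 = 2 :=
    semistabilityIndex_eq_two_of_typeG_three W hX.typeGOrd.typeG hX.addv.2
  obtain ⟨V, iV, iVm, C, hV, hC⟩ := hX.exists_goodOrd_pStar_twist_model W 3 he
  have hordin : IsOrdinaryAt V 3 := ⟨hV.1, hV.2⟩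
  haveI : NeZero (V.conductorNorm ℤ) := ⟨(V.conductorNorm_pos_holds).ne'⟩
  obtain ⟨Dm⟩ := hmodD V
  obtain ⟨ϖ, -, hϖ⟩ := exists_rat_mul_imaginaryPeriodRat_eq_minusPeriod Dm
  obtain ⟨Dh, hB, u, q, hlead, hpgz⟩ := exists_datum_identity_three_of_facts hCyc hArt h73 hWald hmod hmodD
    hmodN hGZK hX.addv.2 hX.typeGOrd hcm hr V C hV hC Dm.isNewformOf ϖ hϖ
  have hSch : SchneiderConjecture Dh :=
    schneiderConjecture_of_identity_of_branchCoeffOneNeZero_odd hp4 hne V C hC hordin Dm.f Dm.isNewformOf ϖ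
      hϖ hpgz
  have hu : MissingUpperBoundAt W 3 :=
    classX4Gord_missingUpperBoundAt_rankOne_of_katoHalf_of_identity_odd hK hGZK hmod hX hp4 hsurj hr hB hSch V hV
      C hC Dm.isNewformOf ϖ hϖ hlead hpgz
  have hl : MissingLowerBoundAt W 3 :=
    missingLowerBoundAt_rankOne_irr_of_twoWitnesses_locallyDivisible hCT hGZK hp2 hX.classX4.2.2 hr hs hsv W' θ hθ
      S hS P₁ P₂ hind hdiv
  exact bsdp_of_missingPPartAt W 3 hGZK (by rw [hr]) (missingPPartAt_of_lower_of_upper W 3 hl hu)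

end Summit.BirchSwinnertonDyer.BirchSwinnertonDyer.Theorems.AdditiveBranchIMCGordTwoRankOne

end
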